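import Summits.BirchSwinnertonDyer.BirchSwinnertonDyer.Theses.PrintX8VSC
import Summits.BirchSwinnertonDyer.BirchSwinnertonDyer.Theorems.SignedLowerHalvesSprungLowerDivisibilityAtThreeIotaDoorContraClosedOfThm714
import Literature.NumberTheory.EllipticCurves.Sprung2012.SharpFlatSelmerDualInvolutionTwistProofs
import HarnessLib

/-!
# Route `PrintX8VSC` (born 2026-08-28T22:3xZ, director-bsd (288)(a)), cruxes K′ `KatoFineLowerSporadicGivenHeldX8Contra` (item 23732) and
# C′ `CyclotomicLowerPosLevelGivenHeldX8Contra` (item 23733): EACH CRUX BY NAME FROM ITS ONE REGISTERED RESIDUE STUB — and K′ is EQUIVALENT to its residue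

Cell `bsd-ssimc` (host), LEAD seat `cruxlead-stmt-BirchSwinnertonDyer-19875` (gen 7, lineage of the γ-keyed parent crux 19875
`SprungLowerDivisibilityAtThree`, line `chromatic-common-zeros`); theorems only (no `def`, no named fact, no instance); closes NO item
(`--supports`). These are the COMPOSITIONS of the line skeletons the LEAD registered on 23732 / 23733 (`ledger skeleton check` OK;
tree copies `Cruxes/SprungLowerDivisibilityAtThree/Lines/twinC_{K,C}prime_iota_door_contra_LEADg7.lean`), landed as theorems so that the
registry statement «each twin crux = its guard + ONE research residue» is citable BY NAME (D-0014 evidence for the planners):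
* §1 `katoFineLowerSporadicGivenHeldX8Contra_of_residue` / `…_iff_residue`: K′ ⟺ «guard → R♮′_spor», where R♮′_spor = the registered stub
  `stub_iotaResidueContra` of 23732 VERBATIM: Kato's fine inequality `ℓ_𝔭(I.H ⧸ Cs.Z) ≤ ℓ_𝔭 Y′.X` at the sporadic common zeros `𝔭` with
  `min_• ℓ_{ι𝔭}(Λ ⧸ range C•.colMap) < ℓ_𝔭(I.H ⧸ Cs.Z)` (Kato 2004 Conj. 12.10 ⊆ at the sporadic ι-orbits with deficient mirror local index;
  OPEN in print at `(3, a₃ = ±3)`; conjecturally EMPTY). The door half is `ChromaticCommonZeros.iotaDoorContra_sporadic_of_heldPack_of_thm714`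
  (LEAD g7 p675240 ∘ w2 g10 p671990/p672134 ∘ w3 g9 p670914); the converse is weakening.
* §2 `cyclotomicLowerPosLevelGivenHeldX8Contra_of_residue`: C′ ⟸ «guard → R♮′_cyc», R♮′_cyc = the registered stub
  `stub_iotaResidueCyclotomicContra` of 23733 VERBATIM (K-form at `T ∉ 𝔭 ∋ Φ_{3^j}(1+T)`, `j < k`; Sprung 2012 Main Conj. 7.21 ⊆ at the
  exceptional twisted zeros with deficient local index; OPEN in print; Rohrlich-finite per curve), via the K-form door
  `ChromaticCommonZeros.iotaDoorContra_posLevel_of_heldPack_of_thm714` and the D′-form conversion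
  `ChromaticCommonZeros.cyclotomicLowerPosLevel_contra_of_katoFineLowerAt` (w3 g9 p671662).
* §3 (APPEND) `residue_of_cyclotomicLowerPosLevelGivenHeldX8Contra` + `cyclotomicLowerPosLevelGivenHeldX8Contra_iff_residue`: the converse for
  C′ — the crux's D′-form at the ♯ colour, read at the ι-twist of a key-γ ♯ dual datum (f.g. torsion by Thm 7.14, transported along the twist:
  `Sprung2012.sharpFlatSelmerDualData_exists_involTwist`, `Kato2004.finite_of_involSemilinear` / `isTorsion_of_involSemilinear`) and the
  normalised `G = ϖ·L♯` (`ChromaticCommonZeros.stub_periodMu`), gives `k ≤ x′` by the four-term identity; so C′ ⟺ «guard → R♮′_cyc» too.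
HONEST FRAMING: nothing is discharged; K′, C′, the residues, K1, leaf X8 and BSD are NOT proved; the guard's facts are printed theorems typed
statement-only. What the theorems SAY is exact bookkeeping: modulo its own guard, each twin crux has no content beyond its residue.

References: [Kato2004Asterisque] Thm. 12.4 (p. 221), Conj. 12.10 (p. 224), (17.13.1) (p. 279–280); [Sprung2012] Thm. 7.14 (3), Thm. 7.16 (p. 1504),
Prop. 7.19, Main Conj. 7.21 (p. 1505); [Matar2020] Thm. 1.1; [KuriharaPollack2007] Problem 3.2; [Sprung2015] Conj. 5.6; [Rohrlich1984] Thm.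
-/

set_option linter.dupNamespace false
set_option autoImplicit false

noncomputable section

open scoped Classical NumberField MatrixGroups ModularForm

open NumberField IsDedekindDomain CongruenceSubgroup WeierstrassCurve Field
  Literature.NumberTheory.EllipticCurves Literature.NumberTheory.EllipticCurves.ModularForms
  Literature.NumberTheory.EllipticCurves.ZpExtension Literature.NumberTheory.EllipticCurves.Sprung2017
  Literature.NumberTheory.EllipticCurves.Sprung2012 Literature.NumberTheory.EllipticCurves.Rank1Residual
  Literature.NumberTheory.EllipticCurves.IwasawaAlgebra Literature.NumberTheory.EllipticCurves.Kato2004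
  Literature.NumberTheory.EllipticCurves.Module
  Summit.BirchSwinnertonDyer.BirchSwinnertonDyer.Theorems

namespace Summit.BirchSwinnertonDyer.BirchSwinnertonDyer.Theorems.PrintX8VSCIotaDoorContra

/-! ### §1 K′ (item 23732) ⟺ its guard + the sporadic ι-residue -/

/-- **K′ BY NAME from its one registered stub** (the skeleton's composition as a theorem): if R♮′_spor — Kato's fine inequality at the sporadic
common zeros OUTSIDE the ι-door, behind the crux's guard (Sprung Thm 7.14, Thm 7.16 print-keyed, period unit at 3, the ι-door pack) —
then `PrintX8VSC.KatoFineLowerSporadicGivenHeldX8Contra`. Inside the door: `ChromaticCommonZeros.iotaDoorContra_sporadic_of_heldPack_of_thm714`.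
[cite: Kato2004Asterisque, Thm. 12.4 (p. 221), Conj. 12.10 (p. 224), (17.13.1) (p. 279–280)] [cite: Sprung2012, Thm. 7.14 (3) (p. 1504)]
[cite: Matar2020, Thm. 1.1] -/
theorem katoFineLowerSporadicGivenHeldX8Contra_of_residue
    (hres :
      thm714_sharpFlatSelmerDual_finite_torsion → thm716_sharpFlatCharIdeal_divisibility_contra →
      realPeriodRat_eq_unit_mul_plusPeriod_three →
      Summit.BirchSwinnertonDyer.BirchSwinnertonDyer.Theses.PrintX8VSC.HeldFactsIotaDoorX8Contra →
      ∀ (W : WeierstrassCurve ℚ) [W.IsElliptic] [W.IsGloballyMinimal] (p : ℕ) [Fact p.Prime]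
      [ContinuousSMul ℤ_[p] (W.tateModule p)] [Module.Free ℤ_[p] (W.tateModule p)]
      [Module.Finite ℤ_[p] (W.tateModule p)],
      ClassX8 W p → ∀ (κ : ZpExtension ℚ p) (γ : Field.absoluteGaloisGroup ℚ),
      κ.IsCyclotomic → κ.IsTopGenerator γ → IsCyclotomicVariable p γ →
      ∀ (v : HeightOneSpectrum (𝓞 ℚ)), (p : 𝓞 ℚ) ∈ v.asIdeal →
      ∀ (g : Field.absoluteGaloisGroup (v.adicCompletion ℚ)),
      κ.IsTopGenerator (resGalOfEmb (closureEmb (K := ℚ) (v.adicCompletion ℚ)) g) →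
      ∀ (cneg : localPoints W (v.adicCompletion ℚ)) (c : ℕ → localPoints W (v.adicCompletion ℚ)),
      IsHondaSystem κ (closureEmb (K := ℚ) (v.adicCompletion ℚ)) W (W.frobeniusTrace p) g cneg c →
      ∀ (N : ℕ) (_ : NeZero N) (f : CuspForm (Gamma0 N) 2) (ϖ : ℚ) (Lsharp Lflat : IwasawaAlgebra p),
      IsNewformOf W f → (ϖ : ℝ) * W.realPeriodRat = plusPeriod f →
      IsSprungPair f p (W.frobeniusTrace p) Lsharp Lflat →
      ∀ (I : Kato2004.IwasawaH1Data W p κ γ)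
      (Cs : SharpFlatColemanKatoDataContra W p f ϖ κ γ (closureEmb (K := ℚ) (v.adicCompletion ℚ))
      (W.frobeniusTrace p) g c Chroma.sharp I)
      (Cf : SharpFlatColemanKatoDataContra W p f ϖ κ γ (closureEmb (K := ℚ) (v.adicCompletion ℚ))
      (W.frobeniusTrace p) g c Chroma.flat I),
      Cs.Z = Cf.Z →
      ∀ (Y : W.FineSelmerDualData κ γ⁻¹) (𝔭 : PrimeSpectrum (IwasawaAlgebra p)), 𝔭.asIdeal.height = 1 →
      (p : IwasawaAlgebra p) ∉ 𝔭.asIdeal →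
      (¬ ∃ n : ℕ, ((cyclotomicOmega p n).map (Int.castRingHom ℤ_[p]) : PowerSeries ℤ_[p]) ∈ 𝔭.asIdeal) →
      (∀ (col' : Chroma) (G' : IwasawaAlgebra p),
      iwasawaToPowerSeries p G' =
      PowerSeries.C (ϖ : ℚ_[p]) * iwasawaToPowerSeries p (chromaticL col' Lsharp Lflat) →
      G' ∈ 𝔭.asIdeal) →
      min (Module.lengthAt (IwasawaAlgebra p) (IwasawaAlgebra p ⧸ LinearMap.range Cs.colMap)
      (PrimeSpectrum.comap (invol p).toRingHom 𝔭))
      (Module.lengthAt (IwasawaAlgebra p) (IwasawaAlgebra p ⧸ LinearMap.range Cf.colMap)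
      (PrimeSpectrum.comap (invol p).toRingHom 𝔭)) <
      Module.lengthAt (IwasawaAlgebra p) (I.H ⧸ Cs.Z) 𝔭 →
      Module.lengthAt (IwasawaAlgebra p) (I.H ⧸ Cs.Z) 𝔭 ≤ Module.lengthAt (IwasawaAlgebra p) Y.X 𝔭) :
    Summit.BirchSwinnertonDyer.BirchSwinnertonDyer.Theses.PrintX8VSC.KatoFineLowerSporadicGivenHeldX8Contra := by
  intro h714 h716c h3 hF W _ _ p _ _ _ _ hX κ γ hκ hγ hcv v hv g hg cneg c hH N hN f ϖ Lsharp Lflat hf hϖ hSP I Cs Cf hZ Y 𝔭 h𝔭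
    hp𝔭 hspor hcommon
  rcases le_or_gt (Module.lengthAt (IwasawaAlgebra p) (I.H ⧸ Cs.Z) 𝔭)
      (min (Module.lengthAt (IwasawaAlgebra p) (IwasawaAlgebra p ⧸ LinearMap.range Cs.colMap)
            (PrimeSpectrum.comap (invol p).toRingHom 𝔭))
        (Module.lengthAt (IwasawaAlgebra p) (IwasawaAlgebra p ⧸ LinearMap.range Cf.colMap)
            (PrimeSpectrum.comap (invol p).toRingHom 𝔭))) with hle | hlt
  · exact ChromaticCommonZeros.iotaDoorContra_sporadic_of_heldPack_of_thm714 hF.1 hF.2.1 hF.2.2 h714 W p hX κ γ hκ hγ hcv v hv g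
      hg cneg c hH N hN f ϖ Lsharp Lflat hf hϖ hSP I Cs Cf hZ Y 𝔭 h𝔭 hp𝔭 hspor hcommon hle
  · exact hres h714 h716c h3 hF W p hX κ γ hκ hγ hcv v hv g hg cneg c hH N hN f ϖ Lsharp Lflat hf hϖ hSP I Cs Cf hZ Y 𝔭 h𝔭 hp𝔭
      hspor hcommon hlt

/-- **The converse (weakening): K′ implies its residue** — the residue statement is K′'s body with one extra hypothesis.
[cite: Kato2004Asterisque, Conj. 12.10 (p. 224)] -/
theorem residue_of_katoFineLowerSporadicGivenHeldX8Contra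
    (hK : Summit.BirchSwinnertonDyer.BirchSwinnertonDyer.Theses.PrintX8VSC.KatoFineLowerSporadicGivenHeldX8Contra) :
      thm714_sharpFlatSelmerDual_finite_torsion → thm716_sharpFlatCharIdeal_divisibility_contra →
      realPeriodRat_eq_unit_mul_plusPeriod_three →
      Summit.BirchSwinnertonDyer.BirchSwinnertonDyer.Theses.PrintX8VSC.HeldFactsIotaDoorX8Contra →
      ∀ (W : WeierstrassCurve ℚ) [W.IsElliptic] [W.IsGloballyMinimal] (p : ℕ) [Fact p.Prime]
      [ContinuousSMul ℤ_[p] (W.tateModule p)] [Module.Free ℤ_[p] (W.tateModule p)]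
      [Module.Finite ℤ_[p] (W.tateModule p)],
      ClassX8 W p → ∀ (κ : ZpExtension ℚ p) (γ : Field.absoluteGaloisGroup ℚ),
      κ.IsCyclotomic → κ.IsTopGenerator γ → IsCyclotomicVariable p γ →
      ∀ (v : HeightOneSpectrum (𝓞 ℚ)), (p : 𝓞 ℚ) ∈ v.asIdeal →
      ∀ (g : Field.absoluteGaloisGroup (v.adicCompletion ℚ)),
      κ.IsTopGenerator (resGalOfEmb (closureEmb (K := ℚ) (v.adicCompletion ℚ)) g) →
      ∀ (cneg : localPoints W (v.adicCompletion ℚ)) (c : ℕ → localPoints W (v.adicCompletion ℚ)),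
      IsHondaSystem κ (closureEmb (K := ℚ) (v.adicCompletion ℚ)) W (W.frobeniusTrace p) g cneg c →
      ∀ (N : ℕ) (_ : NeZero N) (f : CuspForm (Gamma0 N) 2) (ϖ : ℚ) (Lsharp Lflat : IwasawaAlgebra p),
      IsNewformOf W f → (ϖ : ℝ) * W.realPeriodRat = plusPeriod f →
      IsSprungPair f p (W.frobeniusTrace p) Lsharp Lflat →
      ∀ (I : Kato2004.IwasawaH1Data W p κ γ)
      (Cs : SharpFlatColemanKatoDataContra W p f ϖ κ γ (closureEmb (K := ℚ) (v.adicCompletion ℚ))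
      (W.frobeniusTrace p) g c Chroma.sharp I)
      (Cf : SharpFlatColemanKatoDataContra W p f ϖ κ γ (closureEmb (K := ℚ) (v.adicCompletion ℚ))
      (W.frobeniusTrace p) g c Chroma.flat I),
      Cs.Z = Cf.Z →
      ∀ (Y : W.FineSelmerDualData κ γ⁻¹) (𝔭 : PrimeSpectrum (IwasawaAlgebra p)), 𝔭.asIdeal.height = 1 →
      (p : IwasawaAlgebra p) ∉ 𝔭.asIdeal →
      (¬ ∃ n : ℕ, ((cyclotomicOmega p n).map (Int.castRingHom ℤ_[p]) : PowerSeries ℤ_[p]) ∈ 𝔭.asIdeal) →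
      (∀ (col' : Chroma) (G' : IwasawaAlgebra p),
      iwasawaToPowerSeries p G' =
      PowerSeries.C (ϖ : ℚ_[p]) * iwasawaToPowerSeries p (chromaticL col' Lsharp Lflat) →
      G' ∈ 𝔭.asIdeal) →
      min (Module.lengthAt (IwasawaAlgebra p) (IwasawaAlgebra p ⧸ LinearMap.range Cs.colMap)
      (PrimeSpectrum.comap (invol p).toRingHom 𝔭))
      (Module.lengthAt (IwasawaAlgebra p) (IwasawaAlgebra p ⧸ LinearMap.range Cf.colMap)
      (PrimeSpectrum.comap (invol p).toRingHom 𝔭)) <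
      Module.lengthAt (IwasawaAlgebra p) (I.H ⧸ Cs.Z) 𝔭 →
      Module.lengthAt (IwasawaAlgebra p) (I.H ⧸ Cs.Z) 𝔭 ≤ Module.lengthAt (IwasawaAlgebra p) Y.X 𝔭 := by
  intro h714 h716c h3 hF W _ _ p _ _ _ _ hX κ γ hκ hγ hcv v hv g hg cneg c hH N hN f ϖ Lsharp Lflat hf hϖ hSP I Cs Cf hZ Y 𝔭 h𝔭
    hp𝔭 hspor hcommon _
  exact hK h714 h716c h3 hF W p hX κ γ hκ hγ hcv v hv g hg cneg c hH N hN f ϖ Lsharp Lflat hf hϖ hSP I Cs Cf hZ Y 𝔭 h𝔭 hp𝔭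
    hspor hcommon

/-- **K′ ⟺ guard → R♮′_spor**: modulo its own guard the print-keyed sporadic crux IS Kato 2004 Conj. 12.10 ⊆ at the sporadic ι-orbits with
deficient mirror local index — nothing more, nothing less. [cite: Kato2004Asterisque, Conj. 12.10 (p. 224), Thm. 12.4 (p. 221)]
[cite: Sprung2012, Thm. 7.14 (3) (p. 1504)] [cite: Matar2020, Thm. 1.1] [cite: KuriharaPollack2007, Problem 3.2] -/
theorem katoFineLowerSporadicGivenHeldX8Contra_iff_residue :
    Summit.BirchSwinnertonDyer.BirchSwinnertonDyer.Theses.PrintX8VSC.KatoFineLowerSporadicGivenHeldX8Contra ↔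
    (thm714_sharpFlatSelmerDual_finite_torsion → thm716_sharpFlatCharIdeal_divisibility_contra →
    realPeriodRat_eq_unit_mul_plusPeriod_three →
    Summit.BirchSwinnertonDyer.BirchSwinnertonDyer.Theses.PrintX8VSC.HeldFactsIotaDoorX8Contra →
    ∀ (W : WeierstrassCurve ℚ) [W.IsElliptic] [W.IsGloballyMinimal] (p : ℕ) [Fact p.Prime]
    [ContinuousSMul ℤ_[p] (W.tateModule p)] [Module.Free ℤ_[p] (W.tateModule p)]
    [Module.Finite ℤ_[p] (W.tateModule p)],
    ClassX8 W p → ∀ (κ : ZpExtension ℚ p) (γ : Field.absoluteGaloisGroup ℚ),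
    κ.IsCyclotomic → κ.IsTopGenerator γ → IsCyclotomicVariable p γ →
    ∀ (v : HeightOneSpectrum (𝓞 ℚ)), (p : 𝓞 ℚ) ∈ v.asIdeal →
    ∀ (g : Field.absoluteGaloisGroup (v.adicCompletion ℚ)),
    κ.IsTopGenerator (resGalOfEmb (closureEmb (K := ℚ) (v.adicCompletion ℚ)) g) →
    ∀ (cneg : localPoints W (v.adicCompletion ℚ)) (c : ℕ → localPoints W (v.adicCompletion ℚ)),
    IsHondaSystem κ (closureEmb (K := ℚ) (v.adicCompletion ℚ)) W (W.frobeniusTrace p) g cneg c →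
    ∀ (N : ℕ) (_ : NeZero N) (f : CuspForm (Gamma0 N) 2) (ϖ : ℚ) (Lsharp Lflat : IwasawaAlgebra p),
    IsNewformOf W f → (ϖ : ℝ) * W.realPeriodRat = plusPeriod f →
    IsSprungPair f p (W.frobeniusTrace p) Lsharp Lflat →
    ∀ (I : Kato2004.IwasawaH1Data W p κ γ)
    (Cs : SharpFlatColemanKatoDataContra W p f ϖ κ γ (closureEmb (K := ℚ) (v.adicCompletion ℚ))
    (W.frobeniusTrace p) g c Chroma.sharp I)
    (Cf : SharpFlatColemanKatoDataContra W p f ϖ κ γ (closureEmb (K := ℚ) (v.adicCompletion ℚ))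
    (W.frobeniusTrace p) g c Chroma.flat I),
    Cs.Z = Cf.Z →
    ∀ (Y : W.FineSelmerDualData κ γ⁻¹) (𝔭 : PrimeSpectrum (IwasawaAlgebra p)), 𝔭.asIdeal.height = 1 →
    (p : IwasawaAlgebra p) ∉ 𝔭.asIdeal →
    (¬ ∃ n : ℕ, ((cyclotomicOmega p n).map (Int.castRingHom ℤ_[p]) : PowerSeries ℤ_[p]) ∈ 𝔭.asIdeal) →
    (∀ (col' : Chroma) (G' : IwasawaAlgebra p),
    iwasawaToPowerSeries p G' =
    PowerSeries.C (ϖ : ℚ_[p]) * iwasawaToPowerSeries p (chromaticL col' Lsharp Lflat) →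
    G' ∈ 𝔭.asIdeal) →
    min (Module.lengthAt (IwasawaAlgebra p) (IwasawaAlgebra p ⧸ LinearMap.range Cs.colMap)
    (PrimeSpectrum.comap (invol p).toRingHom 𝔭))
    (Module.lengthAt (IwasawaAlgebra p) (IwasawaAlgebra p ⧸ LinearMap.range Cf.colMap)
    (PrimeSpectrum.comap (invol p).toRingHom 𝔭)) <
    Module.lengthAt (IwasawaAlgebra p) (I.H ⧸ Cs.Z) 𝔭 →
    Module.lengthAt (IwasawaAlgebra p) (I.H ⧸ Cs.Z) 𝔭 ≤ Module.lengthAt (IwasawaAlgebra p) Y.X 𝔭) :=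
  ⟨residue_of_katoFineLowerSporadicGivenHeldX8Contra, katoFineLowerSporadicGivenHeldX8Contra_of_residue⟩

/-! ### §2 C′ (item 23733) from its guard + the positive-level cyclotomic ι-residue (K-form) -/

/-- **C′ BY NAME from its one registered stub** (the skeleton's composition as a theorem): if R♮′_cyc — Kato's fine inequality in K-form at
the positive-level cyclotomic common zeros OUTSIDE the door `j < k`, behind the crux's guard — then
`PrintX8VSC.CyclotomicLowerPosLevelGivenHeldX8Contra` (D′-form, by the contragredient four-term identity through
`ChromaticCommonZeros.cyclotomicLowerPosLevel_contra_of_katoFineLowerAt`; inside the door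
`ChromaticCommonZeros.iotaDoorContra_posLevel_of_heldPack_of_thm714`). [cite: Sprung2012, Thm. 7.14 (3) (p. 1504), Prop. 7.19 and Main Conj. 7.21
(p. 1505)] [cite: Kato2004Asterisque, Thm. 12.4 (p. 221), Conj. 12.10 (p. 224), (17.13.1) (p. 279–280)] [cite: Matar2020, Thm. 1.1] -/
theorem cyclotomicLowerPosLevelGivenHeldX8Contra_of_residue
    (hres :
      thm714_sharpFlatSelmerDual_finite_torsion → thm716_sharpFlatCharIdeal_divisibility_contra →
      realPeriodRat_eq_unit_mul_plusPeriod_three →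
      Summit.BirchSwinnertonDyer.BirchSwinnertonDyer.Theses.PrintX8VSC.HeldFactsIotaDoorX8Contra →
      ∀ (W : WeierstrassCurve ℚ) [W.IsElliptic] [W.IsGloballyMinimal] (p : ℕ) [Fact p.Prime]
      [ContinuousSMul ℤ_[p] (W.tateModule p)] [Module.Free ℤ_[p] (W.tateModule p)]
      [Module.Finite ℤ_[p] (W.tateModule p)],
      ClassX8 W p → ∀ (κ : ZpExtension ℚ p) (γ : Field.absoluteGaloisGroup ℚ),
      κ.IsCyclotomic → κ.IsTopGenerator γ → IsCyclotomicVariable p γ →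
      ∀ (v : HeightOneSpectrum (𝓞 ℚ)), (p : 𝓞 ℚ) ∈ v.asIdeal →
      ∀ (g : Field.absoluteGaloisGroup (v.adicCompletion ℚ)),
      κ.IsTopGenerator (resGalOfEmb (closureEmb (K := ℚ) (v.adicCompletion ℚ)) g) →
      ∀ (cneg : localPoints W (v.adicCompletion ℚ)) (c : ℕ → localPoints W (v.adicCompletion ℚ)),
      IsHondaSystem κ (closureEmb (K := ℚ) (v.adicCompletion ℚ)) W (W.frobeniusTrace p) g cneg c →
      ∀ (N : ℕ) (_ : NeZero N) (f : CuspForm (Gamma0 N) 2) (ϖ : ℚ) (Lsharp Lflat : IwasawaAlgebra p),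
      IsNewformOf W f → (ϖ : ℝ) * W.realPeriodRat = plusPeriod f →
      IsSprungPair f p (W.frobeniusTrace p) Lsharp Lflat →
      ∀ (I : Kato2004.IwasawaH1Data W p κ γ)
      (Cs : SharpFlatColemanKatoDataContra W p f ϖ κ γ (closureEmb (K := ℚ) (v.adicCompletion ℚ))
      (W.frobeniusTrace p) g c Chroma.sharp I)
      (Cf : SharpFlatColemanKatoDataContra W p f ϖ κ γ (closureEmb (K := ℚ) (v.adicCompletion ℚ))
      (W.frobeniusTrace p) g c Chroma.flat I),
      Cs.Z = Cf.Z →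
      ∀ (Y : W.FineSelmerDualData κ γ⁻¹) (𝔭 : PrimeSpectrum (IwasawaAlgebra p)), 𝔭.asIdeal.height = 1 →
      (PowerSeries.X : IwasawaAlgebra p) ∉ 𝔭.asIdeal →
      (∃ j : ℕ, 1 ≤ j ∧
      ((((Polynomial.cyclotomic (p ^ j) ℤ).comp (Polynomial.X + 1)).map (Int.castRingHom ℤ_[p]) : Polynomial ℤ_[p]) :
      PowerSeries ℤ_[p]) ∈ 𝔭.asIdeal) →
      (∀ (col' : Chroma) (G' : IwasawaAlgebra p),
      iwasawaToPowerSeries p G' =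
      PowerSeries.C (ϖ : ℚ_[p]) * iwasawaToPowerSeries p (chromaticL col' Lsharp Lflat) →
      G' ∈ 𝔭.asIdeal) →
      min (Module.lengthAt (IwasawaAlgebra p) (IwasawaAlgebra p ⧸ LinearMap.range Cs.colMap) 𝔭)
      (Module.lengthAt (IwasawaAlgebra p) (IwasawaAlgebra p ⧸ LinearMap.range Cf.colMap) 𝔭) <
      Module.lengthAt (IwasawaAlgebra p) (I.H ⧸ Cs.Z) 𝔭 →
      Module.lengthAt (IwasawaAlgebra p) (I.H ⧸ Cs.Z) 𝔭 ≤ Module.lengthAt (IwasawaAlgebra p) Y.X 𝔭) :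
    Summit.BirchSwinnertonDyer.BirchSwinnertonDyer.Theses.PrintX8VSC.CyclotomicLowerPosLevelGivenHeldX8Contra := by
  intro h714 h716c h3 hF
  refine ChromaticCommonZeros.cyclotomicLowerPosLevel_contra_of_katoFineLowerAt ?_
  intro W _ _ p _ _ _ _ hX κ γ hκ hγ hcv v hv g hg cneg c hH N hN f ϖ Lsharp Lflat hf hϖ hSP I Cs Cf hZ Y 𝔭 h𝔭 hT hΦ hcommon
  rcases le_or_gt (Module.lengthAt (IwasawaAlgebra p) (I.H ⧸ Cs.Z) 𝔭)
      (min (Module.lengthAt (IwasawaAlgebra p) (IwasawaAlgebra p ⧸ LinearMap.range Cs.colMap) 𝔭)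
        (Module.lengthAt (IwasawaAlgebra p) (IwasawaAlgebra p ⧸ LinearMap.range Cf.colMap) 𝔭)) with hle | hlt
  · exact ChromaticCommonZeros.iotaDoorContra_posLevel_of_heldPack_of_thm714 hF.1 hF.2.1 hF.2.2 h714 W p hX κ γ hκ hγ hcv v hv g
      hg cneg c hH N hN f ϖ Lsharp Lflat hf hϖ hSP I Cs Cf hZ Y 𝔭 h𝔭 hT hΦ hcommon hle
  · exact hres h714 h716c h3 hF W p hX κ γ hκ hγ hcv v hv g hg cneg c hH N hN f ϖ Lsharp Lflat hf hϖ hSP I Cs Cf hZ Y 𝔭 h𝔭 hT hΦ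
      hcommon hlt

/-! ### §3 (APPEND) The converse for C′: C′ ⟺ its guard + the positive-level cyclotomic ι-residue -/

/-- **C′ ⟹ guard → R♮′_cyc** (the converse of `cyclotomicLowerPosLevelGivenHeldX8Contra_of_residue`): the crux's `D′`-form at the
♯ colour, read at the `ι`-twist of a key-`γ` ♯ dual datum and the normalised `G = ϖ·L♯`, is `k ≤ x′` by the four-term identity — at
every positive-level cyclotomic common zero, inside or outside the door (the residue hypothesis `j < k` is not even used).
[cite: Sprung2012, Thm. 7.14 (3) (p. 1504), Prop. 7.19 (p. 1505)] [cite: Kato2004Asterisque, §17.13 (p. 280)] [cite: GreenbergLNM1716, §1 (p. 60)] -/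
theorem residue_of_cyclotomicLowerPosLevelGivenHeldX8Contra
    (hC : Summit.BirchSwinnertonDyer.BirchSwinnertonDyer.Theses.PrintX8VSC.CyclotomicLowerPosLevelGivenHeldX8Contra) :
    thm714_sharpFlatSelmerDual_finite_torsion → thm716_sharpFlatCharIdeal_divisibility_contra →
    realPeriodRat_eq_unit_mul_plusPeriod_three →
    Summit.BirchSwinnertonDyer.BirchSwinnertonDyer.Theses.PrintX8VSC.HeldFactsIotaDoorX8Contra →
    ∀ (W : WeierstrassCurve ℚ) [W.IsElliptic] [W.IsGloballyMinimal] (p : ℕ) [Fact p.Prime]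
    [ContinuousSMul ℤ_[p] (W.tateModule p)] [Module.Free ℤ_[p] (W.tateModule p)]
    [Module.Finite ℤ_[p] (W.tateModule p)],
    ClassX8 W p → ∀ (κ : ZpExtension ℚ p) (γ : Field.absoluteGaloisGroup ℚ),
    κ.IsCyclotomic → κ.IsTopGenerator γ → IsCyclotomicVariable p γ →
    ∀ (v : HeightOneSpectrum (𝓞 ℚ)), (p : 𝓞 ℚ) ∈ v.asIdeal →
    ∀ (g : Field.absoluteGaloisGroup (v.adicCompletion ℚ)),
    κ.IsTopGenerator (resGalOfEmb (closureEmb (K := ℚ) (v.adicCompletion ℚ)) g) →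
    ∀ (cneg : localPoints W (v.adicCompletion ℚ)) (c : ℕ → localPoints W (v.adicCompletion ℚ)),
    IsHondaSystem κ (closureEmb (K := ℚ) (v.adicCompletion ℚ)) W (W.frobeniusTrace p) g cneg c →
    ∀ (N : ℕ) (_ : NeZero N) (f : CuspForm (Gamma0 N) 2) (ϖ : ℚ) (Lsharp Lflat : IwasawaAlgebra p),
    IsNewformOf W f → (ϖ : ℝ) * W.realPeriodRat = plusPeriod f →
    IsSprungPair f p (W.frobeniusTrace p) Lsharp Lflat →
    ∀ (I : Kato2004.IwasawaH1Data W p κ γ)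
    (Cs : SharpFlatColemanKatoDataContra W p f ϖ κ γ (closureEmb (K := ℚ) (v.adicCompletion ℚ))
    (W.frobeniusTrace p) g c Chroma.sharp I)
    (Cf : SharpFlatColemanKatoDataContra W p f ϖ κ γ (closureEmb (K := ℚ) (v.adicCompletion ℚ))
    (W.frobeniusTrace p) g c Chroma.flat I),
    Cs.Z = Cf.Z →
    ∀ (Y : W.FineSelmerDualData κ γ⁻¹) (𝔭 : PrimeSpectrum (IwasawaAlgebra p)), 𝔭.asIdeal.height = 1 →
    (PowerSeries.X : IwasawaAlgebra p) ∉ 𝔭.asIdeal →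
    (∃ j : ℕ, 1 ≤ j ∧
    ((((Polynomial.cyclotomic (p ^ j) ℤ).comp (Polynomial.X + 1)).map (Int.castRingHom ℤ_[p]) : Polynomial ℤ_[p]) :
    PowerSeries ℤ_[p]) ∈ 𝔭.asIdeal) →
    (∀ (col' : Chroma) (G' : IwasawaAlgebra p),
    iwasawaToPowerSeries p G' =
    PowerSeries.C (ϖ : ℚ_[p]) * iwasawaToPowerSeries p (chromaticL col' Lsharp Lflat) →
    G' ∈ 𝔭.asIdeal) →
    min (Module.lengthAt (IwasawaAlgebra p) (IwasawaAlgebra p ⧸ LinearMap.range Cs.colMap) 𝔭)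
    (Module.lengthAt (IwasawaAlgebra p) (IwasawaAlgebra p ⧸ LinearMap.range Cf.colMap) 𝔭) <
    Module.lengthAt (IwasawaAlgebra p) (I.H ⧸ Cs.Z) 𝔭 →
    Module.lengthAt (IwasawaAlgebra p) (I.H ⧸ Cs.Z) 𝔭 ≤ Module.lengthAt (IwasawaAlgebra p) Y.X 𝔭 := by
  intro h714 h716c h3 hF W _ _ p _ _ _ _ hX κ γ hκ hγ hcv v hv g hg cneg c hH N hN f ϖ Lsharp Lflat hf hϖ hSP I Cs Cf hZ Y 𝔭 h𝔭
    hT hΦ hcommon _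
  haveI : NeZero N := hN
  obtain ⟨hp3, ⟨hgood, hap⟩, -⟩ := id hX
  subst hp3
  have hp2 : (3 : ℕ) ≠ 2 := by decide
  have hirr : W.HasIrreducibleModPGaloisRep 3 := ClassX8.irr' W 3 hX
  have hs : chromaticL Chroma.sharp Lsharp Lflat ≠ 0 :=
    ChromaticBothColours.ClassX8.chromaticL_ne_zero W 3 hX f Lsharp Lflat hf hSP Chroma.sharp
  -- the Néron-normalised ♯ generator `G = ϖ·L♯ ∈ Λ` (`|ϖ|₃ = 1` by the period unit at 3)
  obtain ⟨G, hG⟩ := (ChromaticCommonZeros.stub_periodMu h3 W 3 hX N hN f ϖ Lsharp Lflat hf hϖ hSP).1 Chroma.sharp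
  -- a key-`γ` ♯ dual datum, f.g. torsion by Sprung Thm 7.14; its `ι`-twist `D′` (key `γ⁻¹`) is f.g. torsion as well
  obtain ⟨D⟩ := nonempty_sharpFlatSelmerDualData_rat W κ γ v g c Chroma.sharp
  obtain ⟨hDf, hDt⟩ := h714 W 3 hp2 hgood hap f hf κ γ hκ hγ hcv v hv g hg cneg c hH Chroma.sharp Lsharp Lflat hSP hs D
  obtain ⟨D', e, he, -⟩ := sharpFlatSelmerDualData_exists_involTwist (mul_inv_cancel γ) D
  haveI : Module.Finite (IwasawaAlgebra 3) D.X := hDf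
  haveI : Module.Finite (IwasawaAlgebra 3) D'.X := Kato2004.finite_of_involSemilinear e he
  have hD't : Module.IsTorsion (IwasawaAlgebra 3) D'.X := Kato2004.isTorsion_of_involSemilinear hDt e he
  -- the crux at (♯, D′, G, 𝔭): `m ≤ ℓ D′`
  have hm := hC h714 h716c h3 hF W 3 hX Chroma.sharp κ γ hκ hγ hcv v hv g hg cneg c hH N hN f ϖ Lsharp Lflat hf hϖ hSP hs
    D' hD't G hG I Cs Cf hZ 𝔭 h𝔭 hT hΦ hcommon
  -- the four-term identity `ℓ D′ + k = x′ + m`; `ℓ D′` finite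
  have hid := Cs.lengthAt_add_eq W 3 hirr hSP hs hG D' Y 𝔭 h𝔭
  have hD : Module.lengthAt (IwasawaAlgebra 3) D'.X 𝔭 ≠ ⊤ :=
    IwasawaAlgebra.lengthAt_ne_top_of_isTorsion_of_height_le_one 3 D'.X hD't 𝔭 h𝔭.le
  -- cancel `ℓ D′`: `k + ℓ D′ = x′ + m ≤ x′ + ℓ D′`
  have hle : Module.lengthAt (IwasawaAlgebra 3) (I.H ⧸ Cs.Z) 𝔭 + Module.lengthAt (IwasawaAlgebra 3) D'.X 𝔭 ≤
      Module.lengthAt (IwasawaAlgebra 3) Y.X 𝔭 + Module.lengthAt (IwasawaAlgebra 3) D'.X 𝔭 :=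
    calc Module.lengthAt (IwasawaAlgebra 3) (I.H ⧸ Cs.Z) 𝔭 + Module.lengthAt (IwasawaAlgebra 3) D'.X 𝔭
        = Module.lengthAt (IwasawaAlgebra 3) D'.X 𝔭 + Module.lengthAt (IwasawaAlgebra 3) (I.H ⧸ Cs.Z) 𝔭 := add_comm _ _
      _ = Module.lengthAt (IwasawaAlgebra 3) Y.X 𝔭 +
            Module.lengthAt (IwasawaAlgebra 3) (IwasawaAlgebra 3 ⧸ Ideal.span {G}) 𝔭 := hid
      _ ≤ Module.lengthAt (IwasawaAlgebra 3) Y.X 𝔭 + Module.lengthAt (IwasawaAlgebra 3) D'.X 𝔭 := add_le_add le_rfl hm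
  exact (WithTop.add_le_add_iff_right hD).1 hle

/-- **C′ ⟺ guard → R♮′_cyc**: modulo its own guard the print-keyed positive-level cyclotomic crux IS Sprung 2012 Main Conj. 7.21 ⊆ in
K-form at the exceptional twisted zeros with deficient local index — nothing more, nothing less (the registered stub of 23733 verbatim).
[cite: Sprung2012, Main Conj. 7.21 (p. 1505), Thm. 7.14 (3) (p. 1504)] [cite: Kato2004Asterisque, Conj. 12.10 (p. 224)] [cite: Rohrlich1984, Thm.] -/
theorem cyclotomicLowerPosLevelGivenHeldX8Contra_iff_residue :
    Summit.BirchSwinnertonDyer.BirchSwinnertonDyer.Theses.PrintX8VSC.CyclotomicLowerPosLevelGivenHeldX8Contra ↔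
    (thm714_sharpFlatSelmerDual_finite_torsion → thm716_sharpFlatCharIdeal_divisibility_contra →
    realPeriodRat_eq_unit_mul_plusPeriod_three →
    Summit.BirchSwinnertonDyer.BirchSwinnertonDyer.Theses.PrintX8VSC.HeldFactsIotaDoorX8Contra →
    ∀ (W : WeierstrassCurve ℚ) [W.IsElliptic] [W.IsGloballyMinimal] (p : ℕ) [Fact p.Prime]
    [ContinuousSMul ℤ_[p] (W.tateModule p)] [Module.Free ℤ_[p] (W.tateModule p)]
    [Module.Finite ℤ_[p] (W.tateModule p)],
    ClassX8 W p → ∀ (κ : ZpExtension ℚ p) (γ : Field.absoluteGaloisGroup ℚ),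
    κ.IsCyclotomic → κ.IsTopGenerator γ → IsCyclotomicVariable p γ →
    ∀ (v : HeightOneSpectrum (𝓞 ℚ)), (p : 𝓞 ℚ) ∈ v.asIdeal →
    ∀ (g : Field.absoluteGaloisGroup (v.adicCompletion ℚ)),
    κ.IsTopGenerator (resGalOfEmb (closureEmb (K := ℚ) (v.adicCompletion ℚ)) g) →
    ∀ (cneg : localPoints W (v.adicCompletion ℚ)) (c : ℕ → localPoints W (v.adicCompletion ℚ)),
    IsHondaSystem κ (closureEmb (K := ℚ) (v.adicCompletion ℚ)) W (W.frobeniusTrace p) g cneg c →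
    ∀ (N : ℕ) (_ : NeZero N) (f : CuspForm (Gamma0 N) 2) (ϖ : ℚ) (Lsharp Lflat : IwasawaAlgebra p),
    IsNewformOf W f → (ϖ : ℝ) * W.realPeriodRat = plusPeriod f →
    IsSprungPair f p (W.frobeniusTrace p) Lsharp Lflat →
    ∀ (I : Kato2004.IwasawaH1Data W p κ γ)
    (Cs : SharpFlatColemanKatoDataContra W p f ϖ κ γ (closureEmb (K := ℚ) (v.adicCompletion ℚ))
    (W.frobeniusTrace p) g c Chroma.sharp I)
    (Cf : SharpFlatColemanKatoDataContra W p f ϖ κ γ (closureEmb (K := ℚ) (v.adicCompletion ℚ))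
    (W.frobeniusTrace p) g c Chroma.flat I),
    Cs.Z = Cf.Z →
    ∀ (Y : W.FineSelmerDualData κ γ⁻¹) (𝔭 : PrimeSpectrum (IwasawaAlgebra p)), 𝔭.asIdeal.height = 1 →
    (PowerSeries.X : IwasawaAlgebra p) ∉ 𝔭.asIdeal →
    (∃ j : ℕ, 1 ≤ j ∧
    ((((Polynomial.cyclotomic (p ^ j) ℤ).comp (Polynomial.X + 1)).map (Int.castRingHom ℤ_[p]) : Polynomial ℤ_[p]) :
    PowerSeries ℤ_[p]) ∈ 𝔭.asIdeal) →
    (∀ (col' : Chroma) (G' : IwasawaAlgebra p),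
    iwasawaToPowerSeries p G' =
    PowerSeries.C (ϖ : ℚ_[p]) * iwasawaToPowerSeries p (chromaticL col' Lsharp Lflat) →
    G' ∈ 𝔭.asIdeal) →
    min (Module.lengthAt (IwasawaAlgebra p) (IwasawaAlgebra p ⧸ LinearMap.range Cs.colMap) 𝔭)
    (Module.lengthAt (IwasawaAlgebra p) (IwasawaAlgebra p ⧸ LinearMap.range Cf.colMap) 𝔭) <
    Module.lengthAt (IwasawaAlgebra p) (I.H ⧸ Cs.Z) 𝔭 →
    Module.lengthAt (IwasawaAlgebra p) (I.H ⧸ Cs.Z) 𝔭 ≤ Module.lengthAt (IwasawaAlgebra p) Y.X 𝔭) :=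
  ⟨residue_of_cyclotomicLowerPosLevelGivenHeldX8Contra, cyclotomicLowerPosLevelGivenHeldX8Contra_of_residue⟩

end Summit.BirchSwinnertonDyer.BirchSwinnertonDyer.Theorems.PrintX8VSCIotaDoorContra

end
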